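import Summits.Ventures.YMGap.Thresholds.ImprovedThresholdStar
import Summits.Ventures.YMGap.Thresholds.StarMassGapSUN
import Summits.Ventures.YMGap.RobustBall.IsotropicPairWitness
import Literature.MathematicalPhysics.QuantumFieldTheory.StrongCouplingClustering
import HarnessLib

/-!
# Venture YMGap — FINITE PLAQUETTE SUSCEPTIBILITY: in the strong-coupling window the plaquette–plaquette
# covariances of the DLR state are absolutely summable over all plaquettes of `ℤ^d`, with one bound for all
# base plaquettes

HONEST FRAMING: venture file of the cell `pub-ymgap` (QuantumFields programme), seat ds-1.  Strong-coupling LATTICE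
statement for `SU(N)` lattice Yang–Mills on `ℤ^d` (Wilson action): a COROLLARY of the cell's mass-gap currency
`MassGapAt d N β` (unique DLR state + exponential clustering of Lipschitz cylinder covariances).  «Susceptibility» here
means the lattice sum `χ_p = Σ_q |Cov_μ(W_p, W_q)|` of plaquette covariances, `W_p = (1/N) Re tr U_p` — the quantity
whose finiteness excludes a divergent specific-heat-type response INSIDE the window; nothing about the continuum,
critical behaviour elsewhere, or the Clay problem.

THE THEOREM (`summable_abs_cov_plaquette_of_massGapAt`).  If `MassGapAt d N β` (`d ≥ 1`), then for every DLR state `μ`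
at 't Hooft coupling `β` there is ONE constant `χ` such that for EVERY plaquette `p` of `ℤ^d` the family
`q ↦ |Cov_μ(W_p, W_q)|` is summable over all plaquettes `q` and `Σ_q |Cov_μ(W_p, W_q)| ≤ χ`.
Rows (hypothesis-free, from the cell's mass-gap rows): `SU(2)`, `d = 4` for every 't Hooft `|β| ≤ 9/100` (Wilson
`β_W ≤ 0.36`, `ImprovedThresholdStar.su2_massGapAt_of_abs_le`); every `N ≥ 2`, `d = 4`, `|β| ≤ 9/308`
(`StarSUNLimit.massGapAt_SU_star`).

MECHANISM.  The clustering clause of `MassGapAt` at support size `4` gives, through the tree's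
`abs_cov_zdPlaquetteObs_le_of_decay` (plaquette observables are Lipschitz cylinders; overlapping plaquettes by the
trivial bound), `|Cov_μ(W_p, W_q)| ≤ C' e^{−(c/√d) |x_p − x_q|₂}`; since `|v|₂ ≥ ‖v‖_∞ ≥ ‖v‖₁/d`
(`norm_le_latticeNorm`, `l1_le_mul_norm`) this is `≤ C' r^{‖x_p − x_q‖₁}` with `r = e^{−c/(d√d)} < 1`, and rb-p1's lattice
sum `RobustBall.summable_and_tsum_row_le` (`Σ_q r^{‖x_p − x_q‖₁} ≤ D_d ((1+r)/(1−r))^d`, `D_d` orientations) closes.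

References (mechanism; nothing cited as a named fact): H. Shen, R. Zhu, X. Zhu, CMP 400 (2023), Cor. 1.6 (exponential
clustering); B. Simon, *The Statistical Mechanics of Lattice Gases* I (1993), §II.12 (summable correlations and
susceptibilities).
-/

noncomputable section

open MeasureTheory Function Finset ProbabilityTheory Real
open scoped NNReal
open Literature.Probability.LatticeModels
open Literature.MathematicalPhysics.QuantumLattice (fundamentalRep ymSpecification ymGibbsMeasures LGConfig ZdPlaquette)
open Literature.MathematicalPhysics.QuantumFieldTheory
open Summit.Ventures.YMGap.RobustBall (l1 norm_le_l1 numOrient summable_and_tsum_row_le)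

namespace Summit.Ventures.YMGap.PlaquetteSusceptibility

variable {d N : ℕ}

/-- `‖v‖₁ ≤ d ‖v‖_∞` on `ℤ^d`. [folklore] -/
theorem l1_le_mul_norm (v : Site d) : (l1 v : ℝ) ≤ d * ‖v‖ := by
  unfold l1
  push_cast
  calc ∑ k, (((v k).natAbs : ℕ) : ℝ) ≤ ∑ _k : Fin d, ‖v‖ := Finset.sum_le_sum fun k _ => by
        rw [Nat.cast_natAbs, Int.cast_abs]
        have h := norm_le_pi_norm v k
        rwa [Int.norm_eq_abs] at h
    _ = d * ‖v‖ := by simp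

/-- `e^{−m |v|₂} ≤ (e^{−m/d})^{‖v‖₁}` for `m ≥ 0` (`|v|₂ ≥ ‖v‖_∞ ≥ ‖v‖₁/d`). [folklore] -/
theorem exp_neg_latticeNorm_le_pow (hd : 1 ≤ d) {m : ℝ} (hm : 0 ≤ m) (v : Site d) :
    exp (-m * latticeNorm v) ≤ exp (-(m / d)) ^ l1 v := by
  have hd0 : (0 : ℝ) < d := by exact_mod_cast hd
  rw [← Real.exp_nat_mul]
  refine exp_le_exp.2 ?_
  have h1 : (l1 v : ℝ) ≤ d * latticeNorm v :=
    (l1_le_mul_norm v).trans (mul_le_mul_of_nonneg_left (norm_le_latticeNorm v) hd0.le)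
  have h2 : (l1 v : ℝ) * (m / d) ≤ m * latticeNorm v := by
    rw [mul_div_assoc', div_le_iff₀ hd0]
    nlinarith
  linarith

/-- **FINITE PLAQUETTE SUSCEPTIBILITY from the mass-gap currency.**  `MassGapAt d N β` (`d ≥ 1`) ⇒ for every DLR state
`μ` at 't Hooft coupling `β` there is one `χ` with: for every plaquette `p`, `q ↦ |Cov_μ(W_p, W_q)|` is summable over all
plaquettes of `ℤ^d` and `Σ_q |Cov_μ(W_p, W_q)| ≤ χ`. [cite: arXiv220412737, Cor. 1.6 (Mass gap)] -/
theorem summable_abs_cov_plaquette_of_massGapAt (hd : 1 ≤ d) {β : ℝ} (h : MassGapAt d N β)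
    {μ : Measure (LGConfig d (Matrix.specialUnitaryGroup (Fin N) ℂ))}
    (hμ : μ ∈ ymGibbsMeasures (d := d) (fundamentalRep (Fin N)) (N * β)) :
    ∃ χ : ℝ, ∀ p : ZdPlaquette d,
      Summable (fun q : ZdPlaquette d => |cov[zdPlaquetteObs (fundamentalRep (Fin N)) p.1 p.2.1.1 p.2.1.2,
        zdPlaquetteObs (fundamentalRep (Fin N)) q.1 q.2.1.1 q.2.1.2; μ]|) ∧
        ∑' q : ZdPlaquette d, |cov[zdPlaquetteObs (fundamentalRep (Fin N)) p.1 p.2.1.1 p.2.1.2,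
        zdPlaquetteObs (fundamentalRep (Fin N)) q.1 q.2.1.1 q.2.1.2; μ]| ≤ χ := by
  classical
  have hμ' : IsGibbsMeasure (ymSpecification (d := d) (fundamentalRep (Fin N)) (N * β)) μ := hμ
  haveI := hμ'.isProbabilityMeasure
  obtain ⟨c, hc, hn⟩ := h.2 μ hμ
  obtain ⟨c₁, hc₁⟩ := hn 4
  -- the plaquette–plaquette decay constant of the tree's `abs_cov_zdPlaquetteObs_le_of_decay`
  set C' : ℝ := max (max c₁ 0 * Real.exp (2 * c) *
      (((4 * (N : ℝ≥0) ^ 3 : ℝ≥0) : ℝ) * ((4 * (N : ℝ≥0) ^ 3 : ℝ≥0) : ℝ) + 1)) (4 * Real.exp (2 * c)) with hC'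
  have hC'0 : 0 ≤ C' := le_max_of_le_right (by positivity)
  set r : ℝ := exp (-(c / Real.sqrt d / d)) with hr
  have hr0 : 0 ≤ r := (exp_pos _).le
  have hdpos : (0 : ℝ) < d := by exact_mod_cast (show 0 < d by omega)
  have hr1 : r < 1 := by
    rw [hr]
    refine Real.exp_lt_one_iff.2 (neg_neg_of_pos ?_)
    positivity
  refine ⟨C' * (numOrient d * ((1 + r) / (1 - r)) ^ d), fun p => ?_⟩
  -- pointwise domination by the geometric lattice weight
  have hpt : ∀ q : ZdPlaquette d, |cov[zdPlaquetteObs (fundamentalRep (Fin N)) p.1 p.2.1.1 p.2.1.2,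
        zdPlaquetteObs (fundamentalRep (Fin N)) q.1 q.2.1.1 q.2.1.2; μ]| ≤ C' * r ^ l1 (p.1 - q.1) := by
    intro q
    have hdec := abs_cov_zdPlaquetteObs_le_of_decay (N := N) (by omega) hc hc₁ p.1 q.1 p.2.2 q.2.2
    refine hdec.trans (mul_le_mul_of_nonneg_left ?_ hC'0)
    have := exp_neg_latticeNorm_le_pow hd (div_pos hc (Real.sqrt_pos.2 hdpos)).le (p.1 - q.1)
    simpa only [hr, neg_mul] using this
  have hrow := summable_and_tsum_row_le (d := d) hC'0 hr0 hr1 p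
  have hsum : Summable fun q : ZdPlaquette d => |cov[zdPlaquetteObs (fundamentalRep (Fin N)) p.1 p.2.1.1 p.2.1.2,
        zdPlaquetteObs (fundamentalRep (Fin N)) q.1 q.2.1.1 q.2.1.2; μ]| :=
    Summable.of_nonneg_of_le (fun q => abs_nonneg _) hpt hrow.1
  refine ⟨hsum, ?_⟩
  exact (hsum.tsum_le_tsum hpt hrow.1).trans hrow.2

/-- **`SU(2)`, `d = 4`, hypothesis-free**: at every 't Hooft coupling `|β| ≤ 9/100` (Wilson `β_W = 4β ≤ 0.36`), every DLR
state has finite plaquette susceptibility, uniformly in the base plaquette. [cite: arXiv220412737, Cor. 1.6 (Mass gap)] -/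
theorem su2_summable_abs_cov_plaquette {β : ℝ} (hβ : |β| ≤ 9 / 100)
    {μ : Measure (LGConfig 4 (Matrix.specialUnitaryGroup (Fin 2) ℂ))}
    (hμ : μ ∈ ymGibbsMeasures (d := 4) (fundamentalRep (Fin 2)) (2 * β)) :
    ∃ χ : ℝ, ∀ p : ZdPlaquette 4,
      Summable (fun q : ZdPlaquette 4 => |cov[zdPlaquetteObs (fundamentalRep (Fin 2)) p.1 p.2.1.1 p.2.1.2,
        zdPlaquetteObs (fundamentalRep (Fin 2)) q.1 q.2.1.1 q.2.1.2; μ]|) ∧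
        ∑' q : ZdPlaquette 4, |cov[zdPlaquetteObs (fundamentalRep (Fin 2)) p.1 p.2.1.1 p.2.1.2,
        zdPlaquetteObs (fundamentalRep (Fin 2)) q.1 q.2.1.1 q.2.1.2; μ]| ≤ χ :=
  summable_abs_cov_plaquette_of_massGapAt (by norm_num) (ImprovedThresholdStar.su2_massGapAt_of_abs_le hβ) hμ

/-- **Every `SU(N)`, `N ≥ 2`, `d = 4`, hypothesis-free**: at every 't Hooft coupling `|β| ≤ 9/308` every DLR state has
finite plaquette susceptibility, uniformly in the base plaquette. [cite: arXiv220412737, Cor. 1.6 (Mass gap)] -/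
theorem summable_abs_cov_plaquette_SU (hN : 2 ≤ N) {β : ℝ} (hβ : |β| ≤ 9 / 308)
    {μ : Measure (LGConfig 4 (Matrix.specialUnitaryGroup (Fin N) ℂ))}
    (hμ : μ ∈ ymGibbsMeasures (d := 4) (fundamentalRep (Fin N)) (N * β)) :
    ∃ χ : ℝ, ∀ p : ZdPlaquette 4,
      Summable (fun q : ZdPlaquette 4 => |cov[zdPlaquetteObs (fundamentalRep (Fin N)) p.1 p.2.1.1 p.2.1.2,
        zdPlaquetteObs (fundamentalRep (Fin N)) q.1 q.2.1.1 q.2.1.2; μ]|) ∧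
        ∑' q : ZdPlaquette 4, |cov[zdPlaquetteObs (fundamentalRep (Fin N)) p.1 p.2.1.1 p.2.1.2,
        zdPlaquetteObs (fundamentalRep (Fin N)) q.1 q.2.1.1 q.2.1.2; μ]| ≤ χ :=
  summable_abs_cov_plaquette_of_massGapAt (by norm_num) (StarSUNLimit.massGapAt_SU_star hN hβ) hμ

end Summit.Ventures.YMGap.PlaquetteSusceptibility

end
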